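import Mathlib
import Summits.QuantumFields.YangMills.Theses.FemtoCutoffLadder
import Summits.QuantumFields.YangMills.Theorems.FemtoCutoffLadderLargeFieldInsensitivityRReductions

/-!
# SKELETON «beta-allowance» for the crux `LargeFieldInsensitivityR` (stmt-QuantumFields-26197, route `FemtoCutoffLadder` rev 17; rung R2b1 = RECORD label)

Lead seat `ym-line-fcl-p1` g9 (2026-08-28).  26197 = the lead-g8 repair B′ of the misstated 25696 (planner g5): for every `κ ∈ (0,1)`,
`σ > 0`: clause 1 `0 < t_κ` and the two SF_κ-compressed comparisons at slack `exp(CΛ²/L^σ + A/β²)`.  Two of its three degrees of freedom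
are idle on the proving side (lead g9, `Theorems/FemtoCutoffLadderLargeFieldInsensitivityRReductions.lean`, p611095): clause 1 is
unconditional (`SFCompression.smallFieldTop_pos`, p607603) and the `L`-decaying term can be taken `C = 0`.  So the ONE registered stub is

* `stub_largeFieldBetaAllowance : LargeFieldBetaAllowance` — B‴: for every `κ ∈ (0,1)` there are `A ≥ 0`, `lam0 > 0`, `L0` such that on
  every window lattice `L ≥ L0` (level `≤ lam0`) the two comparisons hold at slack `e^{A/β²}`:
  `λ₁^L t_κ^L ≤ e^{A/β²} s_κ^L λ₀^L` and `s_κ^L λ₀^L ≤ e^{A/β²} λ₁^L t_κ^L`, i.e. `|z_κ − z| ≤ A/β²` UNIFORMLY IN `L` — the honest shape of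
  large-field insensitivity (per-plaquette weight `e^{−cβ^κ}`; the toron sensitivity of a one-plaquette tail event is a winding effect of
  relative order `L^{−4}` on `≍ L⁴` plaquettes per unit physical time ⇒ effect `≍ β^κ e^{−cβ^κ}·O(1) ≤ A/β²`, heuristically).  XL: an
  `L`-uniform decoupling statement for transfer-spectral RATIOS under hard-wall conditioning on an event of vanishing vacuum probability
  (`3L³e^{−cβ^κ} ≫ 1` deep in the tower); Bałaban's R-operation controls actions, not eigenvalue ratios (critic idea-crit-4 06:01Z).
Composition (kernel-checked, in the TREE): `largeFieldInsensitivityR_of_betaAllowance` (p611095).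
HONEST FRAMING: the stub is OPEN, behind `UVStabilityNonUniqueness`; R2b1 is a RECORD rung — not infinite volume, not a mass gap, not Clay.
No summit is proved by this line.
-/

set_option autoImplicit false

noncomputable section

open Literature.MathematicalPhysics.QuantumFieldTheory hiding SU2
open Summit.QuantumFields.YangMills.Theorems.FemtoTransferGap
open Summit.QuantumFields.YangMills.Theorems.FemtoCutoffLadder
open Summit.QuantumFields.YangMills.Theses.FemtoCutoffLadder

namespace Summit.QuantumFields.YangMills.Cruxes.LargeFieldInsensitivityR.BetaAllowance

/-- **B‴ — large-field insensitivity with a pure `β`-allowance** (verbatim the hypothesis of `largeFieldInsensitivityR_of_betaAllowance`). -/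
def LargeFieldBetaAllowance : Prop :=
  ∀ κ : ℝ, 0 < κ → κ < 1 → ∃ (A lam0 : ℝ) (L0 : ℕ), 0 ≤ A ∧ 0 < lam0 ∧
    ∀ lam : ℝ, 0 < lam → lam ≤ lam0 → ∀ (L : ℕ) [NeZero L], L0 ≤ L → ∀ β : ℝ, InFemtoWindow lam β L →
      let P : (GaugeConfig 3 L SU2 → ℝ) → Prop := fun ψ => ∀ U,
        (∃ p : Plaquette 3 L, β ^ (κ - 1) < 2 - (su2Rep (plaquetteHolonomy U p.1 p.2.1.1 p.2.1.2)).trace.re) → ψ U = 0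
      secondValue su2Rep L β ^ L * sSup (rayleighSet su2Rep L β P) ^ L ≤
        Real.exp (A / β ^ 2) *
          (sInf {x : ℝ | ∃ φ : GaugeConfig 3 L SU2 → ℝ, IsPhys φ ∧
            x = sSup (rayleighSet su2Rep L β fun ψ => P ψ ∧ l2 ψ φ = 0)} ^ L * topValue su2Rep L β ^ L) ∧
      sInf {x : ℝ | ∃ φ : GaugeConfig 3 L SU2 → ℝ, IsPhys φ ∧
          x = sSup (rayleighSet su2Rep L β fun ψ => P ψ ∧ l2 ψ φ = 0)} ^ L * topValue su2Rep L β ^ L ≤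
        Real.exp (A / β ^ 2) * (secondValue su2Rep L β ^ L * sSup (rayleighSet su2Rep L β P) ^ L)

/-- stub (the ONLY one; XL): B‴. -/
theorem stub_largeFieldBetaAllowance : LargeFieldBetaAllowance := by
  sorry

/-- ★ The crux child BY NAME from exactly the one declared stub (kernel-checked composition p611095:
`largeFieldInsensitivityR_of_betaAllowance`). -/
theorem LargeFieldInsensitivityR_holds_of_stubs : LargeFieldInsensitivityR :=
  largeFieldInsensitivityR_of_betaAllowance stub_largeFieldBetaAllowance

end Summit.QuantumFields.YangMills.Cruxes.LargeFieldInsensitivityR.BetaAllowance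

end
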